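/-
Origin: expansion seat `planner-pub-hodgecm-pv10-0`, handover #20 2026-08-18T05:05:13Z (`HOME/pub-hodgecm-pv10/lean/Pv10/ResidueFieldsFinite.lean`, md5 d0c7b042, 185 lines);
landed by the gen-6 packager in gate run 22 as `HodgeCM/PerL34/ResidueFieldsFinite.lean` (import ^import Pv[0-9]+\.→import HodgeCM.PerL34. ×1).
-/
/-
# The residue fields of the non-archimedean completions of a number field are finite (kernel)

WIP module `Pv10.ResidueFieldsFinite` (pub-hodgecm-pv10); intended landing
`HodgeCM/PerL34/ResidueFieldsFinite.lean`.

`FiniteAdeleLocallyCompact.lean` reduced local compactness of `𝔸_{K,f}`, `𝔸_Kˣ` and `C_K` to the atom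
`ResidueFieldsFinite K` (∀ v ∤ ∞, the residue field of `K_v` is finite; Neukirch II §5 (5.1)–(5.2),
PDF p. 127 [corpus:book:bynd-algebraic-number-theory p.127]).  This file PROVES the atom from Mathlib:
the reduction map `𝓞 K → 𝒪_v → 𝒪_v/𝓂_v` is surjective (density of `K` in `K_v` + `R_𝔭/𝔭R_𝔭 = R/𝔭`,
done by hand with `valuationSubringAtPrime_eq_valuationSubring` and `Ideal.IsMaximal.exists_inv`) and
factors through the finite ring `𝓞 K ⧸ 𝔭_v`.  Consequently (`…_unconditional` corollaries) the finite
adele ring, the idele group and the idele class group of every number field are locally compact and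
`C_K` is compactly coherent — with NO hypothesis.  No PerL/QW8/2001 statement is used.
-/
import Summits.HodgeConjecture.HodgeCM.PerL34.FiniteAdeleLocallyCompact
import Mathlib.LinearAlgebra.FreeModule.IdealQuotient

/-! PORT of `HodgeCM/PerL34/ResidueFieldsFinite.lean` (HodgeCMPerL run 82) — verbatim mechanical port; provenance in the PORT header line. -/

set_option autoImplicit false

noncomputable section

open Topology Set

namespace NumberField

open IsDedekindDomain IsDedekindDomain.HeightOneSpectrum
open scoped Valued

variable (K : Type*) [Field K] [NumberField K]

/-- `R → R_𝔭/𝔭R_𝔭` is onto: a `v`-integral element of `K` is congruent mod `𝔭_v` to an algebraic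
integer. -/
theorem exists_ringOfIntegers_valuation_sub_lt_one (v : HeightOneSpectrum (𝓞 K)) (k : K)
    (hk : v.valuation K k ≤ 1) : ∃ r : 𝓞 K, v.valuation K (k - r) < 1 := by
  have hmem : k ∈ valuationSubringAtPrime K v := by
    rw [valuationSubringAtPrime_eq_valuationSubring]; exact hk
  obtain ⟨a, s, hs, rfl⟩ :
      ∃ (a s : 𝓞 K) (_ : s ∈ v.asIdeal.primeCompl),
        k = algebraMap (𝓞 K) K a * (algebraMap (𝓞 K) K s)⁻¹ := hmem
  have hs' : s ∉ v.asIdeal := hs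
  obtain ⟨t, i, hi, hti⟩ := (HeightOneSpectrum.isMaximal v).exists_inv hs'
  have hs0 : (algebraMap (𝓞 K) K s) ≠ 0 := by
    intro h0
    apply hs'
    have : s = 0 := (map_eq_zero_iff _ (FaithfulSMul.algebraMap_injective (𝓞 K) K)).mp h0
    rw [this]; exact zero_mem _
  refine ⟨a * t, ?_⟩
  have key : algebraMap (𝓞 K) K a * (algebraMap (𝓞 K) K s)⁻¹ - ((a * t : 𝓞 K) : K) =
      algebraMap (𝓞 K) K a * (algebraMap (𝓞 K) K s)⁻¹ * algebraMap (𝓞 K) K i := by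
    have hi' : algebraMap (𝓞 K) K i = 1 - algebraMap (𝓞 K) K t * algebraMap (𝓞 K) K s := by
      rw [← map_mul, ← map_one (algebraMap (𝓞 K) K), ← hti, map_add, map_mul]; ring
    rw [hi']
    change _ - algebraMap (𝓞 K) K (a * t) = _
    rw [map_mul]
    field_simp
  rw [key, map_mul, map_mul, map_inv₀, valuation_of_algebraMap, valuation_of_algebraMap,
    valuation_of_algebraMap, (intValuation_eq_one_iff_mem_primeCompl v s).mpr hs, inv_one, mul_one]
  calc v.intValuation a * v.intValuation i ≤ 1 * v.intValuation i := by
        gcongr; exact intValuation_le_one v a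
    _ = v.intValuation i := one_mul _
    _ < 1 := (intValuation_lt_one_iff_mem v i).mpr hi

/-- Density of `K` in `K_v`, in the form needed: every element of `K_v` is within the open unit
ball of an element of `K`. -/
theorem exists_field_valuation_sub_lt_one (v : HeightOneSpectrum (𝓞 K)) (x : v.adicCompletion K) :
    ∃ k : K, Valued.v (algebraMap K (v.adicCompletion K) k - x) < 1 := by
  have hopen : IsOpen {y : v.adicCompletion K | Valued.v.restrict (y - x) < 1} :=
    (Valued.isOpen_ball (v.adicCompletion K) 1).preimage (continuous_id.sub continuous_const)
  have hmem : {y : v.adicCompletion K | Valued.v.restrict (y - x) < 1} ∈ 𝓝 x :=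
    hopen.mem_nhds (by simp)
  obtain ⟨k, hk⟩ := (denseRange_algebraMap (K := K) v).mem_nhds hmem
  exact ⟨k, by simpa only [Set.mem_setOf_eq, Valuation.restrict_lt_one_iff] using hk⟩

/-- `𝓞 K → 𝒪_v` (Mathlib's `algebraMap (𝓞 K) (v.adicCompletionIntegers K)`, in the `Valued.integer`
spelling `𝒪[K_v]` used by `Mathlib.Topology.Algebra.Valued.LocallyCompact`). -/
def toInteger (v : HeightOneSpectrum (𝓞 K)) : 𝓞 K →+* 𝒪[v.adicCompletion K] :=
  algebraMap (𝓞 K) (v.adicCompletionIntegers K)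

/-- (Ported verbatim from the HodgeCMPerL package; no docstring in the source.) -/
theorem coe_toInteger (v : HeightOneSpectrum (𝓞 K)) (r : 𝓞 K) :
    ((toInteger K v r : 𝒪[v.adicCompletion K]) : v.adicCompletion K) =
      algebraMap K (v.adicCompletion K) (r : K) :=
  rfl

/-- The reduction map `𝓞 K → 𝒪_v → 𝓀(v) = 𝒪_v / 𝓂_v`. -/
def toResidueField (v : HeightOneSpectrum (𝓞 K)) : 𝓞 K →+* 𝓀[v.adicCompletion K] :=
  (IsLocalRing.residue 𝒪[v.adicCompletion K]).comp (toInteger K v)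

/-- (Ported verbatim from the HodgeCMPerL package; no docstring in the source.) -/
theorem toResidueField_apply (v : HeightOneSpectrum (𝓞 K)) (r : 𝓞 K) :
    toResidueField K v r = IsLocalRing.residue 𝒪[v.adicCompletion K] (toInteger K v r) :=
  rfl

/-- **The reduction map `𝓞 K → 𝓀(v)` is surjective.** -/
theorem toResidueField_surjective (v : HeightOneSpectrum (𝓞 K)) :
    Function.Surjective (toResidueField K v) := by
  intro y
  obtain ⟨x, rfl⟩ := IsLocalRing.residue_surjective y
  obtain ⟨k, hk⟩ := exists_field_valuation_sub_lt_one K v (x : v.adicCompletion K)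
  have hkx : Valued.v (algebraMap K (v.adicCompletion K) k) ≤ 1 := by
    have h := Valuation.map_add Valued.v (algebraMap K (v.adicCompletion K) k - x) (x : v.adicCompletion K)
    rw [sub_add_cancel] at h
    exact h.trans (max_le hk.le x.2)
  have hk1 : v.valuation K k ≤ 1 := by
    rwa [show algebraMap K (v.adicCompletion K) k = (k : v.adicCompletion K) from rfl,
      valuedAdicCompletion_eq_valuation'] at hkx
  obtain ⟨r, hr⟩ := exists_ringOfIntegers_valuation_sub_lt_one K v k hk1
  refine ⟨r, ?_⟩
  rw [toResidueField_apply, ← sub_eq_zero, ← map_sub, IsLocalRing.residue_eq_zero_iff,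
    IsLocalRing.mem_maximalIdeal, mem_nonunits_iff, Valuation.Integer.not_isUnit_iff_valuation_lt_one]
  have hcoe : ((toInteger K v r - x : 𝒪[v.adicCompletion K]) : v.adicCompletion K) =
      algebraMap K (v.adicCompletion K) (r : K) - x := rfl
  rw [hcoe]
  have hsplit : algebraMap K (v.adicCompletion K) (r : K) - x =
      (algebraMap K (v.adicCompletion K) (r : K) - algebraMap K (v.adicCompletion K) k) +
        (algebraMap K (v.adicCompletion K) k - x) := by abel
  rw [hsplit]
  refine lt_of_le_of_lt (Valuation.map_add Valued.v _ _) (max_lt ?_ hk)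
  rw [← map_sub, show algebraMap K (v.adicCompletion K) ((r : K) - k) =
      (((r : K) - k : K) : v.adicCompletion K) from rfl, valuedAdicCompletion_eq_valuation',
    Valuation.map_sub_swap]
  exact hr

/-- `𝔭_v ≠ 0`, so `𝓞 K ⧸ 𝔭_v` is finite. -/
theorem finite_quotient_asIdeal (v : HeightOneSpectrum (𝓞 K)) : Finite (𝓞 K ⧸ v.asIdeal) :=
  Ideal.finiteQuotientOfFreeOfNeBot v.asIdeal v.ne_bot

/-- The reduction map kills `𝔭_v`. -/
theorem toResidueField_eq_zero_of_mem (v : HeightOneSpectrum (𝓞 K)) (r : 𝓞 K)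
    (hr : r ∈ v.asIdeal) : toResidueField K v r = 0 := by
  rw [toResidueField_apply, IsLocalRing.residue_eq_zero_iff, IsLocalRing.mem_maximalIdeal,
    mem_nonunits_iff, Valuation.Integer.not_isUnit_iff_valuation_lt_one]
  have hcoe : ((toInteger K v r : 𝒪[v.adicCompletion K]) : v.adicCompletion K) =
      ((r : K) : v.adicCompletion K) := rfl
  rw [hcoe, valuedAdicCompletion_eq_valuation', valuation_of_algebraMap]
  exact (intValuation_lt_one_iff_mem v r).mpr hr

/-- **Neukirch II (5.1)/(5.2), kernel version: the residue field of `K_v` is finite.** -/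
theorem finite_residueField_adicCompletion (v : HeightOneSpectrum (𝓞 K)) :
    Finite 𝓀[v.adicCompletion K] := by
  haveI := finite_quotient_asIdeal K v
  -- factor the surjection `𝓞 K → 𝓀(v)` through the finite ring `𝓞 K ⧸ 𝔭_v`
  let φ : 𝓞 K ⧸ v.asIdeal →+* 𝓀[v.adicCompletion K] :=
    Ideal.Quotient.lift v.asIdeal (toResidueField K v) (fun r hr => toResidueField_eq_zero_of_mem K v r hr)
  have hφ : Function.Surjective φ := by
    intro y
    obtain ⟨r, rfl⟩ := toResidueField_surjective K v y
    exact ⟨Ideal.Quotient.mk _ r, by simp [φ]⟩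
  exact Finite.of_surjective φ hφ

/-- The atom of `FiniteAdeleLocallyCompact.lean`, now a theorem. -/
theorem residueFieldsFinite : ResidueFieldsFinite K :=
  fun v => finite_residueField_adicCompletion K v

/-- `𝒪_v` is compact, unconditionally. -/
instance compactSpace_adicCompletionIntegers_unconditional (v : HeightOneSpectrum (𝓞 K)) :
    CompactSpace (v.adicCompletionIntegers K) :=
  compactSpace_adicCompletionIntegers K v (finite_residueField_adicCompletion K v)

/-- `K_v` is locally compact, unconditionally. -/
instance locallyCompactSpace_adicCompletion_unconditional (v : HeightOneSpectrum (𝓞 K)) :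
    LocallyCompactSpace (v.adicCompletion K) :=
  locallyCompactSpace_adicCompletion K v (finite_residueField_adicCompletion K v)

/-- **The finite adele ring of a number field is locally compact** (unconditional). -/
theorem finiteAdeleRingLocallyCompact : FiniteAdeleRingLocallyCompact K :=
  finiteAdeleRingLocallyCompact_of_residueFieldsFinite K (residueFieldsFinite K)

/-- **The idele group of a number field is locally compact** (unconditional). -/
instance locallyCompactSpace_ideleGroup_unconditional : LocallyCompactSpace (ideleGroup K) :=
  locallyCompactSpace_ideleGroup K (finiteAdeleRingLocallyCompact K)

/-- **The idele class group `C_K` of a number field is locally compact** (unconditional). -/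
instance locallyCompactSpace_ideleClassGroup_unconditional :
    LocallyCompactSpace (IdeleClassGroup K) :=
  locallyCompactSpace_ideleClassGroup K (finiteAdeleRingLocallyCompact K)

/-- **`C_K` is compactly coherent** (unconditional) — the second instance hypothesis of
`ProperCriterion.isProperMap_of_comp_factor` at `C := C_K`. -/
instance compactlyCoherentSpace_ideleClassGroup_unconditional :
    CompactlyCoherentSpace (IdeleClassGroup K) :=
  compactlyCoherentSpace_ideleClassGroup K (finiteAdeleRingLocallyCompact K)

end NumberField

end
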